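import Mathlib
import Literature.MathematicalPhysics.QuantumFieldTheory.Balaban1983to89.B14ChangeOfVariables

/-!
# `Balaban1983to89.B14Eq124Jacobians` — T. Bałaban, *Convergent renormalization expansions for lattice gauge theories*, Commun. Math. Phys. **119** (1988) 243–285 [Balaban1988Convergent]: (1.24) p. 252 — the exponentiated Jacobian of the bondwise change of variables (1.22) — PROVED, and the finite resummation (1.25) p. 252 (with (1.18) p. 250) PROVED as cube-indicator algebra

statement-level skeleton of published theorems with citation tags; proofs where landed; nothing here is a claim about the Yang–Mills mass gap

PDF held: `paper:balaban1988-cmp119-convergent-renormalization` (journal page = PDF page + 242); displays read on the page renders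
`…-p008-x4.png` (p. 250), `…-p009-x4.png` (p. 251), `…-p010-x4.png` (p. 252) of
`run/shared/lean/pub/pub-balaban/b2b-balaban-ref1/pages/1988-cmp119-convergent-renormalization/`, READ AS IMAGES.

WHAT IS REPRODUCED (Phase-2 seat p28 of the mega-formalization `lit-balaban`, SKELETON row `B14.Eq1.23-1.25`, displays (1.24)
and (1.25); (1.23) is the sibling file `…B14Eq123Localization` of the same seat; (1.22) itself — `newVar`, `bF`, `IsCutoff` —
is r11's `…B14.ChangeOfVariables`, imported and used BY NAME).
p. 252 [PDF 10], verbatim: *"The change of variables produces new terms in the effective action in (1.15). The Jacobians of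
the transformations (1.22) can be exponentiated, as in (20) [16], and they yield the expression
  Σ_{b∈S₁*} Tr log[ 1 + (∂/∂A(b)) ( −(1/g₀) g(A(b)) 𝐇_{1,Ax}(b) + (1/g₀) 𝐅(....) ) ].        (1.24)
… After the change of variables we obtain an expansion of the form (1.15), but with the additional sum over Λ₀ [sic],
the characteristic function χ₀′(Ω₁) replaced by
  Σ_{R₁} χ^{(0)}(Λ₁) χ^{(0)}(R₁ᶜ ∩ Λ₁ᶜ) χ^{(0)c}(R₁) χ₀′(S₁),        (1.25)
and with the additional term V^{(0)}(S₁) in the effective action."*  The ingredients of (1.25), p. 250 [PDF 8]: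
*"We introduce a new decomposition of unity in the domain Ω₁^{∼−1} = ((Ω₁ᶜ)^∼)ᶜ:
1 = Σ_{R₁} Π_{□′⊂R₁ᶜ} χ({sup_{b∈(□′^{∼2})*} |A(b)| < g₀⁻¹δ₀}) · Π_{□′⊂R₁} χ({sup_{b∈(□′^{∼2})*} |A(b)| ≥ g₀⁻¹δ₀})
= Σ_{R₁} χ^{(0)}(R₁ᶜ) χ^{(0)c}(R₁). (1.18) Here the summation is over sets R₁ ⊂ Ω₁^{∼−1}, which are unions of L²M₂R₁-cubes,
and R₁ᶜ means the complement to Ω₁^{∼−1}. … Thus the second function in the product (1.19) is equal to 1, and we can omit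
it. These functions remain only for □′ ⊂ (Ω₁∖Ω₁^{∼−1}) ∪ R₁"*, and p. 251 [PDF 9], (1.20): *"Λ₁ = Ω₁^{∼−2} ∩ (R₁′^∼)ᶜ,
S₁ = (Ω₁∖Ω₁^{∼−1}) ∪ R₁."*  "(20) [16]" = [Balaban1985UV3] (20) p. 261 (cell paper B10; B14's references are [I] = B12
"and references therein", whose [16] is CMP 102 UV-stability), the tree's `…B10Eq20Locality` (the block-diagonal Jacobian
of a change of variables with printed support, `det(I − ·) = Π_c det(1 − J_c) = exp Σ_c log det(1 − J_c)`).

WHAT IS KERNEL-CERTIFIED (0 sorry, 0 new definitions; Mathlib + `…B14.ChangeOfVariables`).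
§1 (1.24), the mechanism, for ANY bondwise change of variables `Ψ(A′)(b) = ψ_b(A′(b))` of configurations `A′ : β → V`
   (`β` a finite bond set, `V` a finite-dimensional normed space = the model of 𝐠): if `ψ_b` has Fréchet derivative `D_b` at
   `A′(b)` then `Ψ` has derivative `⊕_b D_b` (`hasFDerivAt_bondwise`), its Jacobian determinant is `Π_b det D_b`
   (`det_bondwise`, Mathlib `ContinuousLinearMap.det_pi`) = `Π_{b∈S} det D_b` when `ψ_b = id` off `S` (`det_bondwise_support`);
   over `ℝ`, `‖D_b − 1‖ < 1 ⇒ det D_b > 0` (`det_pos_of_norm_sub_one_lt`, Neumann series + intermediate value theorem), so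
   THE JACOBIAN EXPONENTIATES: `det DΨ(A′) = exp Σ_{b∈S} log det(1 + E_b)`, `E_b = D_b − 1` = the derivative of `ψ_b − id`
   (`eq124_bondwise`).  READING: the printed `Tr log[1 + X]` is certified in the form `log det(1 + X)` (the two agree for
   `‖X‖ < 1`; the operator-logarithm form `exp Tr mlog T = det T` is the tree's `…B12JacobianTrLog268.cexp_trace_mlog_eq_det`
   over `ℂ`; here the variables are REAL (𝐠-valued) and the cut-off `g` of (1.22) is only real-smooth, so the Jacobian is a
   real determinant and the scalar form is the one that is exact without a complexification) — cf. the same reading in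
   `…B10Eq20Locality.eq20_exp_sum_log` (cell DIVERGENCE D-b13.19 (p6)).
§2 (1.24) for THE transformations (1.22): with r11's `newVar g₀ g H` (first line of (1.22)) on the bonds of `S = S₁*`
   (bond-dependent cut-off `gb b` = `g` on `(R₁^{∼2}∩S₁)*`, `≡ 1` on `S₁*∖(R₁^{∼2})*` — p. 252 "with the function g(A′(b))
   replaced by 1") and the identity off `S`: the differentiated expression of (1.24) IS `newVar g₀ g H A − A =
   −(g₀⁻¹ g(A))·H − g₀⁻¹·𝐅(g₀A, −g(A)H)` (`newVar_sub_self`, from r11's `eq122`; the display prints "+ (1/g₀)𝐅(....)" with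
   the arguments elided — the sign and arguments of the 𝐅-term are those of (1.22), TRANSCRIPTION NOTE, nothing adjudicated),
   and for any Fréchet derivatives `E_b` of these maps with `‖E_b‖ < 1` the Jacobian of the whole substitution is
   `exp Σ_{b∈S₁*} log det(1 + E_b)` (`eq124`).  The ambient space is r11's complete normed `ℂ`-algebra `𝔸 ⊇ 𝐠` viewed as a
   real space (`[FiniteDimensional ℝ 𝔸]`, e.g. `𝔸 = M_N(ℂ)`); the restriction to the real subspace 𝐠 is not typed (as in
   `…B14.ChangeOfVariables`).
§3 (1.25) with (1.18): for cube-indexed indicator values `a □ ∈ {0,1}` (the small-FLUCTUATION-field functions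
   `χ({sup |A(b)| < g₀⁻¹δ₀})` of (1.18), so `1 − a □` = the large-field ones) and `c □` (the cube factors of `χ₀′`), finite cube
   families `I ⊆ Ω` (the cubes of `Ω₁^{∼−1} ⊆ Ω₁`), any `Λ(R) ⊆ I∖R` (print: `Λ₁ = Ω₁^{∼−2} ∩ (R₁′^∼)ᶜ`), and the printed
   in-proof input *"the second function in the product (1.19) is equal to 1"* on small-field cubes AS A HYPOTHESIS
   (`a □ = 1 → c □ = 1` on `I`; its proof from `|U₁U_{1,□′}⁻¹ − 1| < O(1)B₃e^{−δLM₂R₁}ε₁` is analysis, not typed):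
   (1.18) `Π_{□∈I}(a □ + (1 − a □)) = 1 = Σ_{R⊆I} Π_{I∖R} a · Π_R (1 − a)` (`eq118`) and
   (1.25) `χ₀′(Ω₁) := Π_{□∈Ω} c □ = Σ_{R⊆I} [Π_{Λ(R)} a]·[Π_{(I∖R)∖Λ(R)} a]·[Π_R (1 − a)]·[Π_{(Ω∖I)∪R} c]`
   = `Σ_{R₁} χ^{(0)}(Λ₁) χ^{(0)}(R₁ᶜ∩Λ₁ᶜ) χ^{(0)c}(R₁) χ₀′(S₁)` with `S₁ = (Ω₁∖Ω₁^{∼−1}) ∪ R₁` (`eq125_resummation`) — a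
   finite resummation, PROVED (`Finset.prod_add`).
Axioms of every theorem ⊆ {propext, Classical.choice, Quot.sound}.

WHAT IS *NOT* REPRODUCED OR ASSERTED: differentiability of `newVar` and the smallness `‖E_b‖ < 1` (inputs — they need the
bounds on 𝐇_{1,Ax}, B11 (190)); the identification `Tr mlog = log det` over `ℝ`; the new action term `V^{(0)}(S₁, A, 𝐇_{1,Ax})`
and its bounds ("bounded by any positive power of g₀"); which cubes/bonds the sets `Ω₁, R₁, Λ₁, S₁` are (cube geometry:
`…B14Sect1Sets`, `…B14DomainGeom`); anything of (1.15).  Value = kernel certificate of the printed finite-dimensional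
calculus/combinatorics at a located step, NOT summit progress.

Unit `lit-balaban-p28` (Phase-2 proof seat p28, agent literature-prover-lit-balaban-p28-0; target assigned by lead ruling
G.5-9, 2026-08-21T00:09Z), HOME `run/shared/lean/pub/lit-balaban/` (PHASE2-TARGETS.md §G.6; seat log `lit-balaban-p28/STATUS.md`).

## References
* [Balaban1988Convergent] T. Bałaban, Commun. Math. Phys. 119 (1988) 243–285, doi:10.1007/bf01217741, (1.18) p. 250, (1.20),
  (1.22) p. 251, (1.24), (1.25) p. 252.
* [Balaban1985UV3] T. Bałaban, Commun. Math. Phys. 102 (1985) 255–275, (20) p. 261 (= "(20) [16]" of B14 p. 252).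
-/

noncomputable section

open scoped BigOperators
open Set Finset

namespace Literature.MathematicalPhysics.QuantumFieldTheory.Balaban1983to89.B14Eq124Jacobians

open Literature.MathematicalPhysics.QuantumFieldTheory.Balaban1983to89

/-! ## §1. (1.24), the mechanism: the Jacobian of a bondwise change of variables factorises over the bonds and exponentiates -/

section Bondwise

variable {𝕜 : Type*} [NontriviallyNormedField 𝕜] {β : Type*} [Fintype β]
  {V : Type*} [NormedAddCommGroup V] [NormedSpace 𝕜 V]

/-- **The derivative of a bondwise change of variables** `Ψ(A′)(b) = ψ_b(A′(b))` (the shape of (1.22): each new bond variable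
`A(b)` is a function of `A′(b)` alone) is the direct sum `⊕_b D_b` of the bond derivatives — the block-diagonal Jacobian
behind (1.24). [cite: Balaban1988Convergent, (1.24) p.252] -/
theorem hasFDerivAt_bondwise {ψ : β → V → V} {D : β → V →L[𝕜] V} {A' : β → V}
    (h : ∀ b, HasFDerivAt (ψ b) (D b) (A' b)) :
    HasFDerivAt (fun A : β → V => fun b => ψ b (A b))
      (ContinuousLinearMap.pi fun b => (D b).comp (ContinuousLinearMap.proj b)) A' :=
  hasFDerivAt_pi.2 fun b => (h b).comp A' (hasFDerivAt_apply b A')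

variable [FiniteDimensional 𝕜 V]

/-- **The Jacobian determinant of a bondwise change of variables is the product of the bond Jacobians**:
`det(⊕_b D_b) = Π_b det D_b` (Mathlib `ContinuousLinearMap.det_pi`). [cite: Balaban1988Convergent, (1.24) p.252] -/
theorem det_bondwise (D : β → V →L[𝕜] V) :
    (ContinuousLinearMap.pi fun b => (D b).comp (ContinuousLinearMap.proj b)).det = ∏ b, (D b).det :=
  ContinuousLinearMap.det_pi D

/-- … and only the bonds where the substitution is non-trivial contribute: if `D_b = 1` off `S` (print: the change of
variables acts on `b ∈ S₁*` only) then `det(⊕_b D_b) = Π_{b∈S} det D_b`. [cite: Balaban1988Convergent, (1.24) p.252] -/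
theorem det_bondwise_support (S : Finset β) (D : β → V →L[𝕜] V) (hD : ∀ b ∉ S, D b = 1) :
    (ContinuousLinearMap.pi fun b => (D b).comp (ContinuousLinearMap.proj b)).det = ∏ b ∈ S, (D b).det := by
  rw [ContinuousLinearMap.det_pi]
  refine (Finset.prod_subset (Finset.subset_univ S) fun b _ hb => ?_).symm
  rw [hD b hb]
  simp [ContinuousLinearMap.det]

end Bondwise

section Real

variable {W : Type*} [NormedAddCommGroup W] [NormedSpace ℝ W] [FiniteDimensional ℝ W]

/-- **Why the Jacobian exponentiates (real variables)**: an endomorphism `T` of a finite-dimensional real normed space with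
`‖T − 1‖ < 1` has `det T > 0` — `1 + t(T − 1)` is invertible for `t ∈ [0,1]` (Neumann series), so `t ↦ det(1 + t(T − 1))` is a
continuous nowhere-vanishing path from `det 1 = 1` to `det T` (intermediate value theorem). [cite: Balaban1988Convergent, (1.24) p.252] -/
theorem det_pos_of_norm_sub_one_lt {T : W →L[ℝ] W} (hT : ‖T - 1‖ < 1) : 0 < T.det := by
  haveI : CompleteSpace W := FiniteDimensional.complete ℝ W
  -- the path of endomorphisms and its determinant
  set γ : ℝ → (W →L[ℝ] W) := fun t => 1 + t • (T - 1) with hγ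
  have hcont : Continuous fun t => (γ t).det :=
    ContinuousLinearMap.continuous_det.comp (continuous_const.add (continuous_id.smul continuous_const))
  -- nowhere zero on `[0,1]`
  have hne : ∀ t ∈ Icc (0 : ℝ) 1, (γ t).det ≠ 0 := by
    intro t ht
    have hnorm : ‖-(t • (T - 1))‖ < 1 := by
      rw [norm_neg, norm_smul, Real.norm_of_nonneg ht.1]
      calc t * ‖T - 1‖ ≤ 1 * ‖T - 1‖ := by gcongr; exact ht.2
        _ < 1 := by rw [one_mul]; exact hT
    have hunit : IsUnit (γ t) := by
      have hu := (Units.oneSub (-(t • (T - 1))) hnorm).isUnit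
      rwa [Units.val_oneSub, sub_neg_eq_add] at hu
    have hunit' : IsUnit ((γ t : W →L[ℝ] W) : W →ₗ[ℝ] W) := hunit.map ContinuousLinearMap.toLinearMapRingHom
    exact (LinearMap.isUnit_det _ hunit').ne_zero
  have h0 : (γ 0).det = 1 := by
    simp [hγ, ContinuousLinearMap.det]
  have h1 : γ 1 = T := by simp [hγ]
  -- intermediate value theorem
  by_contra hle
  rw [not_lt] at hle
  have hmem : (0 : ℝ) ∈ Icc ((fun t => (γ t).det) 1) ((fun t => (γ t).det) 0) := by
    simp only [h1, h0]
    exact ⟨hle, zero_le_one⟩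
  obtain ⟨t, ht, ht0⟩ := intermediate_value_Icc' zero_le_one hcont.continuousOn hmem
  exact hne t ht ht0

/-- **(1.24), the mechanism, assembled** — for a bondwise change of variables `Ψ(A′)(b) = ψ_b(A′(b))` on a finite bond set,
`ψ_b = id` off `S`, with bond derivatives `1 + E_b` at `A′(b)` (`E_b` = the derivative of `ψ_b − id`) and `‖E_b‖ < 1` on `S`:
`Ψ` is differentiable at `A′` and ITS JACOBIAN IS THE EXPONENTIAL OF A SUM OVER THE BONDS OF `S`,
`det DΨ(A′) = exp[ Σ_{b∈S} log det(1 + E_b) ]` (the printed `Tr log[1 + ∂(ψ_b − id)/∂A(b)]` in the `log det` form).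
[cite: Balaban1988Convergent, (1.24) p.252] -/
theorem eq124_bondwise {β : Type*} [Fintype β] [DecidableEq β] (S : Finset β) {ψ : β → W → W}
    (hid : ∀ b ∉ S, ψ b = id) {E : β → W →L[ℝ] W} {A' : β → W}
    (hE : ∀ b ∈ S, HasFDerivAt (fun X => ψ b X - X) (E b) (A' b)) (hsmall : ∀ b ∈ S, ‖E b‖ < 1) :
    HasFDerivAt (fun A : β → W => fun b => ψ b (A b))
        (ContinuousLinearMap.pi fun b => (if b ∈ S then 1 + E b else 1).comp (ContinuousLinearMap.proj b)) A'
      ∧ (ContinuousLinearMap.pi fun b =>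
            (if b ∈ S then 1 + E b else (1 : W →L[ℝ] W)).comp (ContinuousLinearMap.proj b)).det
          = Real.exp (∑ b ∈ S, Real.log (1 + E b).det) := by
  have hderiv : ∀ b, HasFDerivAt (ψ b) (if b ∈ S then 1 + E b else 1) (A' b) := by
    intro b
    by_cases hb : b ∈ S
    · rw [if_pos hb]
      have h := ((hasFDerivAt_id (𝕜 := ℝ) (A' b)).add (hE b hb))
      have h2 : HasFDerivAt (ψ b) (ContinuousLinearMap.id ℝ W + E b) (A' b) :=
        h.congr_of_eventuallyEq (Filter.Eventually.of_forall fun X => by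
          simp only [Pi.add_apply, id, add_sub_cancel])
      rw [ContinuousLinearMap.one_def]
      exact h2
    · rw [if_neg hb, hid b hb]
      simpa [ContinuousLinearMap.one_def] using hasFDerivAt_id (𝕜 := ℝ) (A' b)
  refine ⟨hasFDerivAt_bondwise hderiv, ?_⟩
  rw [det_bondwise_support S _ fun b hb => if_neg hb, Real.exp_sum]
  refine Finset.prod_congr rfl fun b hb => ?_
  rw [if_pos hb]
  have hpos : 0 < (1 + E b).det := det_pos_of_norm_sub_one_lt (by simpa using hsmall b hb)
  exact (Real.exp_log hpos).symm

end Real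

/-! ## §2. (1.24) for the transformations (1.22) of `B14.ChangeOfVariables` -/

section ChangeOfVariables

open B14.ChangeOfVariables

variable {𝔸 : Type*} [NormedRing 𝔸] [NormedAlgebra ℂ 𝔸]

/-- **The expression differentiated in (1.24) is (1.22) minus the identity**: for `g₀ ≠ 0`,
`newVar g₀ g H A − A = −(g₀⁻¹ g(A))·H − g₀⁻¹·𝐅(g₀A, −g(A)H)` — r11's `eq122` rearranged (the display (1.24) prints the
bracket as "−(1/g₀) g(A(b)) 𝐇_{1,Ax}(b) + (1/g₀) 𝐅(....)", arguments of 𝐅 elided; sign and arguments here are those of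
(1.22), transcription note). [cite: Balaban1988Convergent, (1.24) p.252] -/
theorem newVar_sub_self {g₀ : ℝ} (hg0 : g₀ ≠ 0) (g : 𝔸 → ℝ) (H A : 𝔸) :
    newVar g₀ g H A - A
      = -(((g₀ : ℂ)⁻¹ * ((g A : ℝ) : ℂ)) • H) - (g₀ : ℂ)⁻¹ • bF ((g₀ : ℂ) • A) (-(((g A : ℝ) : ℂ) • H)) := by
  rw [eq122 hg0 g H A]
  abel

variable [FiniteDimensional ℝ 𝔸] {β : Type*} [Fintype β] [DecidableEq β]

/-- **(1.24)** (p. 252 [PDF 10], verbatim: *"The Jacobians of the transformations (1.22) can be exponentiated, as in (20) [16],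
and they yield the expression Σ_{b∈S₁*} Tr log[1 + (∂/∂A(b))(−(1/g₀) g(A(b)) 𝐇_{1,Ax}(b) + (1/g₀) 𝐅(....))]. (1.24)"*), for
THE substitution (1.22): on the bonds `b ∈ S` (= `S₁*`) the new variable is r11's `newVar g₀ (gb b) (H b) (A′(b))` (first
line of (1.22); `gb b` = the cut-off `g` on `(R₁^{∼2}∩S₁)*` and `≡ 1` on `S₁*∖(R₁^{∼2})*`, `H b = 𝐇_{1,Ax}(b)`), off `S` it is
`A′(b)`; IF each `A ↦ newVar g₀ (gb b) (H b) A − A` has a Fréchet derivative `E_b` at `A′(b)` with `‖E_b‖ < 1` (inputs), THEN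
the substitution is differentiable at `A′` with derivative `⊕_b (1 + E_b)` and its Jacobian is
`exp[ Σ_{b∈S} log det(1 + E_b) ]` — the exponentiated form (1.24), `log det` reading (§1).  Model: `𝔸` = r11's complete
normed `ℂ`-algebra containing 𝐠, as a finite-dimensional REAL space. [cite: Balaban1988Convergent, (1.24) p.252] -/
theorem eq124 (S : Finset β) (g₀ : ℝ) (gb : β → 𝔸 → ℝ) (H A' : β → 𝔸) {E : β → 𝔸 →L[ℝ] 𝔸}
    (hE : ∀ b ∈ S, HasFDerivAt (fun X => newVar g₀ (gb b) (H b) X - X) (E b) (A' b))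
    (hsmall : ∀ b ∈ S, ‖E b‖ < 1) :
    HasFDerivAt (fun A : β → 𝔸 => fun b => if b ∈ S then newVar g₀ (gb b) (H b) (A b) else A b)
        (ContinuousLinearMap.pi fun b => (if b ∈ S then 1 + E b else 1).comp (ContinuousLinearMap.proj b)) A'
      ∧ (ContinuousLinearMap.pi fun b =>
            (if b ∈ S then 1 + E b else (1 : 𝔸 →L[ℝ] 𝔸)).comp (ContinuousLinearMap.proj b)).det
          = Real.exp (∑ b ∈ S, Real.log (1 + E b).det) := by
  have h := eq124_bondwise S (ψ := fun b X => if b ∈ S then newVar g₀ (gb b) (H b) X else X)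
    (fun b hb => by funext X; simp [hb]) (E := E) (A' := A')
    (fun b hb => by simpa [hb] using hE b hb) hsmall
  simpa using h

end ChangeOfVariables

/-! ## §3. (1.18) and (1.25): the decomposition of unity over `R₁` and the resummation replacing `χ₀′(Ω₁)` -/

section Resummation

variable {ι : Type*} [DecidableEq ι]

/-- **(1.18)** (p. 250 [PDF 8]): *"1 = Σ_{R₁} Π_{□′⊂R₁ᶜ} χ({sup |A(b)| < g₀⁻¹δ₀}) · Π_{□′⊂R₁} χ({sup |A(b)| ≥ g₀⁻¹δ₀})
= Σ_{R₁} χ^{(0)}(R₁ᶜ) χ^{(0)c}(R₁)"* — with `a □` the value of the small-field function of the cube `□` (so `1 − a □` is the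
large-field one) and `I` the cubes of `Ω₁^{∼−1}`: `Σ_{R⊆I} Π_{□∈I∖R} a □ · Π_{□∈R} (1 − a □) = 1` (expand `Π_{□∈I}(a □ + (1 − a □))`;
the same device as (1.1)/(1.4)/(1.8), `…B14Sect1Sets.decompUnity`). [cite: Balaban1988Convergent, (1.18) p.250] -/
theorem eq118 (I : Finset ι) (a : ι → ℝ) :
    ∑ R ∈ I.powerset, (∏ c ∈ I \ R, a c) * ∏ c ∈ R, (1 - a c) = 1 := by
  calc ∑ R ∈ I.powerset, (∏ c ∈ I \ R, a c) * ∏ c ∈ R, (1 - a c)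
      = ∑ t ∈ I.powerset, (∏ i ∈ t, (1 - a i)) * ∏ i ∈ I \ t, a i :=
        Finset.sum_congr rfl fun R _ => mul_comm _ _
    _ = ∏ c ∈ I, (1 - a c + a c) := (Finset.prod_add _ _ _).symm
    _ = 1 := by simp

/-- **(1.25)** (p. 252 [PDF 10]: *"the characteristic function χ₀′(Ω₁) replaced by Σ_{R₁} χ^{(0)}(Λ₁) χ^{(0)}(R₁ᶜ∩Λ₁ᶜ)
χ^{(0)c}(R₁) χ₀′(S₁)"*, with (1.20) `S₁ = (Ω₁∖Ω₁^{∼−1}) ∪ R₁`, `Λ₁ ⊆ R₁ᶜ = Ω₁^{∼−1}∖R₁`) — THE FINITE RESUMMATION: cube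
families `I ⊆ Ω` (cubes of `Ω₁^{∼−1} ⊆ Ω₁`), small-field indicator VALUES `a □ ∈ {0,1}` on `I`, the cube factors `c □` of
`χ₀′`, any `Λ(R) ⊆ I∖R`, and the printed in-proof input (p. 250: *"the second function in the product (1.19) is equal to
1, and we can omit it"*) as the hypothesis `a □ = 1 → c □ = 1` on `I`; then
`Π_{□∈Ω} c □ = Σ_{R⊆I} (Π_{Λ(R)} a)(Π_{(I∖R)∖Λ(R)} a)(Π_R (1 − a))(Π_{(Ω∖I)∪R} c)`, i.e.
`χ₀′(Ω₁) = Σ_{R₁} χ^{(0)}(Λ₁) χ^{(0)}(R₁ᶜ∩Λ₁ᶜ) χ^{(0)c}(R₁) χ₀′(S₁)`. [cite: Balaban1988Convergent, (1.25) p.252] -/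
theorem eq125_resummation (Ω I : Finset ι) (hI : I ⊆ Ω) (Λ : Finset ι → Finset ι) (hΛ : ∀ R, Λ R ⊆ I \ R)
    (a c : ι → ℝ) (ha : ∀ q ∈ I, a q = 0 ∨ a q = 1) (hc : ∀ q ∈ I, a q = 1 → c q = 1) :
    ∏ q ∈ Ω, c q
      = ∑ R ∈ I.powerset, (∏ q ∈ Λ R, a q) * (∏ q ∈ (I \ R) \ Λ R, a q) * (∏ q ∈ R, (1 - a q))
          * ∏ q ∈ (Ω \ I) ∪ R, c q := by
  -- `a·c = a` on `I` (the χ₀′-factor of a small-field cube is 1)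
  have hac : ∀ q ∈ I, a q * c q = a q := by
    intro q hq
    rcases ha q hq with h0 | h1
    · rw [h0, zero_mul]
    · rw [h1, hc q hq h1, one_mul]
  -- split `Ω = (Ω∖I) ⊔ I` and insert (1.18) in front of `Π_I c`
  have hsplit : ∏ q ∈ Ω, c q = (∏ q ∈ Ω \ I, c q) * ∏ q ∈ I, c q := (Finset.prod_sdiff hI).symm
  have hkey : ∏ q ∈ I, c q
      = ∑ R ∈ I.powerset, ((∏ q ∈ I \ R, a q) * ∏ q ∈ R, (1 - a q)) * ∏ q ∈ I, c q := by
    rw [← Finset.sum_mul, eq118 I a, one_mul]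
  rw [hsplit, hkey, Finset.mul_sum]
  refine Finset.sum_congr rfl fun R hR => ?_
  have hRI : R ⊆ I := Finset.mem_powerset.mp hR
  -- `Π_{I∖R} a · Π_I c = Π_{I∖R} a · Π_R c`
  have hI' : ∏ q ∈ I, c q = (∏ q ∈ I \ R, c q) * ∏ q ∈ R, c q := (Finset.prod_sdiff hRI).symm
  have hkill : (∏ q ∈ I \ R, a q) * ∏ q ∈ I \ R, c q = ∏ q ∈ I \ R, a q := by
    rw [← Finset.prod_mul_distrib]
    exact Finset.prod_congr rfl fun q hq => hac q (Finset.mem_sdiff.mp hq).1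
  -- `Π_{Ω∖I} c · Π_R c = Π_{(Ω∖I)∪R} c`
  have hdisj : Disjoint (Ω \ I) R :=
    Finset.disjoint_left.mpr fun q hq hqR => (Finset.mem_sdiff.mp hq).2 (hRI hqR)
  have hunion : ∏ q ∈ (Ω \ I) ∪ R, c q = (∏ q ∈ Ω \ I, c q) * ∏ q ∈ R, c q := Finset.prod_union hdisj
  -- `Π_{I∖R} a = Π_{Λ R} a · Π_{(I∖R)∖Λ R} a`
  have hΛsplit : ∏ q ∈ I \ R, a q = (∏ q ∈ Λ R, a q) * ∏ q ∈ (I \ R) \ Λ R, a q := by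
    rw [mul_comm]; exact (Finset.prod_sdiff (hΛ R)).symm
  calc (∏ q ∈ Ω \ I, c q) * ((∏ q ∈ I \ R, a q) * (∏ q ∈ R, (1 - a q)) * ∏ q ∈ I, c q)
      = (∏ q ∈ Ω \ I, c q) * (((∏ q ∈ I \ R, a q) * ∏ q ∈ I \ R, c q) * (∏ q ∈ R, (1 - a q)) * ∏ q ∈ R, c q) := by
        rw [hI']; ring
    _ = (∏ q ∈ Λ R, a q) * (∏ q ∈ (I \ R) \ Λ R, a q) * (∏ q ∈ R, (1 - a q)) * ∏ q ∈ (Ω \ I) ∪ R, c q := by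
        rw [hkill, hunion, hΛsplit]; ring

end Resummation

end Literature.MathematicalPhysics.QuantumFieldTheory.Balaban1983to89.B14Eq124Jacobians
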